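import Mathlib.NumberTheory.Padics.RingHoms
import Mathlib.LinearAlgebra.Matrix.GeneralLinearGroup.Card
import Mathlib.GroupTheory.Index
import Mathlib.Data.ZMod.Units
import HarnessLib

/-!
# Principal congruence subgroups of `GL₂(ℤ_p)`: reduction modulo `pʳ` and the indices
# `[GL₂(ℤ_p) : K_r] = |GL₂(ℤ/pʳℤ)|` and `[GL₂(ℤ_p) : ℤ_pˣ K_r] = |PGL₂(ℤ/pʳℤ)| = p^{3r−2}(p² − 1)`

Topic `Literature/GroupTheory/Index`; Mathlib only. Definitions (`GL2.congruenceSubgroup`,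
`GL2.scalarSubgroup`) and theorems; no named facts.

The `p`-adic volume `Vol(PGL₂(ℤ_p)) = 1 − p⁻²` in Bhargava–Shankar's local mass formula (Ann. of
Math. 181 (2015), proof of Prop. 5.12 of `arXiv:1006.1002v2` = Prop. 3.9 of the published
version: "the volume of `PGL₂(ℤ_p)` with respect to the Haar measure obtained from the `N̄AN`
decomposition … is equal to `(1 − 1/p²)`") enters the tree's orbit-counting argument as the
number of cosets of the group `ℤ_pˣ · K_r` (`K_r` the principal congruence subgroup of level
`pʳ`), i.e. as `|PGL₂(ℤ/pʳℤ)| = p^{3r}(1 − p⁻²)`. This file computes these indices: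

* `GL2.congruenceSubgroup r = K_r = ker(GL₂(ℤ_p) → GL₂(ℤ/pʳℤ))`, membership `g ≡ 1 (mod pʳ)`
  entrywise (`GL2.mem_congruenceSubgroup_iff`); `GL2.scalarSubgroup = ℤ_pˣ · 1`;
* `GL2.map_toZModPow_surjective` — **reduction `GL₂(ℤ_p) → GL₂(ℤ/pʳℤ)` is surjective** (lift the
  entries; a `p`-adic integer is a unit iff it is a unit modulo `pʳ`, `r ≥ 1`);
* `card_GL_two_zmod_primePow` — **`|GL₂(ℤ/pʳℤ)| = p^{4(r−1)} (p² − 1)(p² − p)`** for `r ≥ 1`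
  (a matrix over `ℤ/pʳℤ` is invertible iff its reduction modulo `p` is, and the fibres of
  `M₂(ℤ/pʳℤ) → M₂(𝔽_p)` have `p^{4(r−1)}` elements; `|GL₂(𝔽_p)|` is Mathlib's `Matrix.card_GL_field`);
* `GL2.index_congruenceSubgroup` — `[GL₂(ℤ_p) : K_r] = p^{4(r−1)} (p² − 1)(p² − p)`;
* `GL2.relIndex_congruenceSubgroup_scalarSubgroup` — `[ℤ_pˣ : ℤ_pˣ ∩ K_r] = φ(pʳ) = p^{r−1}(p − 1)`
  (`ℤ_pˣ → (ℤ/pʳℤ)ˣ` is surjective);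
* `GL2.index_scalar_sup_congruenceSubgroup` — **`[GL₂(ℤ_p) : ℤ_pˣ K_r] = p^{3r−2}(p² − 1)`**
  (`= |PGL₂(ℤ/pʳℤ)|`).

## References

* M. Bhargava, A. Shankar, Ann. of Math. (2) 181 (2015) 191–242, proof of Prop. 5.12
  (arXiv:1006.1002v2; Prop. 3.9 / Cor. 3.8 of the published version): `Vol(PGL₂(ℤ_p)) = 1 − p⁻²`.
  [cite: BhargavaShankarAnnals2015, Prop. 5.12 proof (Vol(PGL₂(ℤ_p)) = 1 − p⁻²; arXiv:1006.1002v2 numbering)]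
* The structure of `GL₂` over `ℤ/pʳℤ` and congruence subgroups. [folklore]
-/

noncomputable section

open scoped Classical
open Matrix

namespace Literature.GroupTheory.Index

namespace GL2

variable {p : ℕ} [Fact p.Prime]

/-! ## The congruence subgroups and the scalars -/

/-- **The principal congruence subgroup** `K_r = ker(GL₂(ℤ_p) → GL₂(ℤ/pʳℤ))` of `GL₂(ℤ_p)`.
[folklore] -/
def congruenceSubgroup (r : ℕ) : Subgroup (GL (Fin 2) ℤ_[p]) :=
  (Matrix.GeneralLinearGroup.map (PadicInt.toZModPow r)).ker

/-- `K_r` is normal. [folklore] -/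
instance congruenceSubgroup_normal (r : ℕ) : (congruenceSubgroup (p := p) r).Normal :=
  inferInstanceAs (MonoidHom.ker _).Normal

/-- Membership in `K_r`: all entries of `g − 1` are divisible by `pʳ`. [folklore] -/
theorem mem_congruenceSubgroup_iff (r : ℕ) (g : GL (Fin 2) ℤ_[p]) :
    g ∈ congruenceSubgroup r ↔
      ∀ i j, (p : ℤ_[p]) ^ r ∣ (g : Matrix (Fin 2) (Fin 2) ℤ_[p]) i j - (1 : Matrix (Fin 2) (Fin 2) ℤ_[p]) i j := by
  rw [congruenceSubgroup, MonoidHom.mem_ker, Units.ext_iff]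
  change ((g : Matrix (Fin 2) (Fin 2) ℤ_[p]).map (PadicInt.toZModPow r)) = (1 : Matrix (Fin 2) (Fin 2) (ZMod (p ^ r))) ↔ _
  rw [← Matrix.map_one (PadicInt.toZModPow r) (map_zero _) (map_one _)]
  simp only [← Matrix.ext_iff, Matrix.map_apply]
  refine forall_congr' fun i ↦ forall_congr' fun j ↦ ?_
  rw [← sub_eq_zero, ← map_sub, ← RingHom.mem_ker, PadicInt.ker_toZModPow, Ideal.mem_span_singleton]

/-- The scalar matrices `ℤ_pˣ · 1 ≤ GL₂(ℤ_p)`, as the range of `c ↦ c · 1`. [folklore] -/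
def scalarSubgroup : Subgroup (GL (Fin 2) ℤ_[p]) := (Units.map (Matrix.scalar (Fin 2)).toMonoidHom).range

/-- The matrix of the scalar `c · 1`. [folklore] -/
theorem coe_scalar (c : ℤ_[p]ˣ) :
    ((Units.map (Matrix.scalar (Fin 2)).toMonoidHom c : GL (Fin 2) ℤ_[p]) : Matrix (Fin 2) (Fin 2) ℤ_[p]) =
      (c : ℤ_[p]) • (1 : Matrix (Fin 2) (Fin 2) ℤ_[p]) := by
  simp [Matrix.smul_one_eq_diagonal]

/-- `c ↦ c · 1` is injective. [folklore] -/
theorem scalar_injective : Function.Injective (Units.map (Matrix.scalar (Fin 2)).toMonoidHom : ℤ_[p]ˣ →* GL (Fin 2) ℤ_[p]) := by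
  intro c c' h
  have h' := congrArg (fun g : GL (Fin 2) ℤ_[p] ↦ (g : Matrix (Fin 2) (Fin 2) ℤ_[p]) 0 0) h
  simp only [coe_scalar, Matrix.smul_apply, Matrix.one_apply_eq, smul_eq_mul, mul_one] at h'
  exact Units.ext h'

/-- Membership in the scalars: `g = c · 1` for a unit `c`. [folklore] -/
theorem mem_scalarSubgroup_iff (g : GL (Fin 2) ℤ_[p]) :
    g ∈ scalarSubgroup ↔ ∃ c : ℤ_[p]ˣ, (g : Matrix (Fin 2) (Fin 2) ℤ_[p]) = (c : ℤ_[p]) • (1 : Matrix (Fin 2) (Fin 2) ℤ_[p]) := by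
  constructor
  · rintro ⟨c, rfl⟩; exact ⟨c, coe_scalar c⟩
  · rintro ⟨c, hc⟩
    refine ⟨c, Units.ext ?_⟩
    rw [coe_scalar, hc]

/-- `c · 1 ∈ K_r` iff `c ≡ 1 (mod pʳ)`. [folklore] -/
theorem scalar_mem_congruenceSubgroup_iff (r : ℕ) (c : ℤ_[p]ˣ) :
    (Units.map (Matrix.scalar (Fin 2)).toMonoidHom c : GL (Fin 2) ℤ_[p]) ∈ congruenceSubgroup r ↔
      (p : ℤ_[p]) ^ r ∣ (c : ℤ_[p]) - 1 := by
  rw [mem_congruenceSubgroup_iff]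
  simp only [coe_scalar, Matrix.smul_apply, smul_eq_mul]
  constructor
  · intro h; simpa using h 0 0
  · intro h i j
    by_cases hij : i = j
    · subst hij; simpa using h
    · simp [Matrix.one_apply_ne hij]

/-! ## Units of `ℤ_p` modulo `pʳ` -/

/-- A lift of a residue modulo `pʳ`: `toZModPow r (x.val) = x`. [folklore] -/
theorem toZModPow_natCast_val (r : ℕ) (x : ZMod (p ^ r)) : PadicInt.toZModPow r ((x.val : ℕ) : ℤ_[p]) = x := by
  rw [map_natCast, ZMod.natCast_zmod_val]

/-- **A `p`-adic integer is a unit iff its reduction modulo `pʳ` is a unit** (`r ≥ 1`). [folklore] -/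
theorem isUnit_iff_isUnit_toZModPow {r : ℕ} (hr : 1 ≤ r) (a : ℤ_[p]) :
    IsUnit a ↔ IsUnit (PadicInt.toZModPow r a) := by
  constructor
  · exact fun h ↦ h.map _
  · intro h
    -- `a` is not in the maximal ideal: otherwise `p ∣ a` and the image would be nilpotent
    by_contra hna
    have hmem : a ∈ IsLocalRing.maximalIdeal ℤ_[p] := by
      rwa [IsLocalRing.mem_maximalIdeal, mem_nonunits_iff]
    rw [PadicInt.maximalIdeal_eq_span_p, Ideal.mem_span_singleton] at hmem
    obtain ⟨b, rfl⟩ := hmem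
    rw [map_mul, map_natCast] at h
    have hp : ¬ IsUnit ((p : ZMod (p ^ r))) := by
      rw [ZMod.isUnit_iff_coprime]
      intro hcop
      have : Nat.Coprime p p := by
        have h1 : p ∣ p ^ r := dvd_pow_self p (by omega)
        exact Nat.Coprime.coprime_dvd_right h1 hcop
      rw [Nat.coprime_self] at this
      exact (Fact.out : p.Prime).one_lt.ne' this
    exact hp (isUnit_of_mul_isUnit_left h)

/-- **`ℤ_pˣ → (ℤ/pʳℤ)ˣ` is surjective.** [folklore] -/
theorem unitsMap_toZModPow_surjective {r : ℕ} (hr : 1 ≤ r) :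
    Function.Surjective (Units.map (PadicInt.toZModPow (p := p) r).toMonoidHom) := by
  intro u
  have hx : IsUnit (PadicInt.toZModPow r (((u : ZMod (p ^ r)).val : ℕ) : ℤ_[p])) := by
    rw [toZModPow_natCast_val]; exact Units.isUnit u
  obtain ⟨a, ha⟩ := (isUnit_iff_isUnit_toZModPow hr _).mpr hx
  refine ⟨a, Units.ext ?_⟩
  simp [ha]

/-- The kernel of `ℤ_pˣ → (ℤ/pʳℤ)ˣ` is `1 + pʳℤ_p`, i.e. the preimage of `K_r` under `c ↦ c · 1`.
[folklore] -/
theorem comap_scalar_congruenceSubgroup (r : ℕ) :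
    (congruenceSubgroup r).comap (Units.map (Matrix.scalar (Fin 2)).toMonoidHom : ℤ_[p]ˣ →* GL (Fin 2) ℤ_[p]) =
      (Units.map (PadicInt.toZModPow (p := p) r).toMonoidHom).ker := by
  ext c
  rw [Subgroup.mem_comap, scalar_mem_congruenceSubgroup_iff, MonoidHom.mem_ker, Units.ext_iff]
  simp only [Units.coe_map, RingHom.toMonoidHom_eq_coe, MonoidHom.coe_coe, Units.val_one]
  rw [← Ideal.mem_span_singleton, ← PadicInt.ker_toZModPow, RingHom.mem_ker, map_sub, map_one, sub_eq_zero]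

/-- **`[ℤ_pˣ : 1 + pʳℤ_p] = φ(pʳ) = p^{r−1}(p − 1)`** (`r ≥ 1`). [folklore] -/
theorem index_ker_unitsMap_toZModPow {r : ℕ} (hr : 1 ≤ r) :
    (Units.map (PadicInt.toZModPow (p := p) r).toMonoidHom).ker.index = p ^ (r - 1) * (p - 1) := by
  rw [Subgroup.index_ker, MonoidHom.range_eq_top.mpr (unitsMap_toZModPow_surjective hr), Subgroup.card_top,
    Nat.card_eq_fintype_card, ZMod.card_units_eq_totient, Nat.totient_prime_pow (Fact.out : p.Prime) hr]

/-- **`[ℤ_pˣ·1 : ℤ_pˣ·1 ∩ K_r] = p^{r−1}(p − 1)`**, as the relative index of `K_r` in the scalars.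
[folklore] -/
theorem relIndex_congruenceSubgroup_scalarSubgroup {r : ℕ} (hr : 1 ≤ r) :
    (congruenceSubgroup (p := p) r).relIndex scalarSubgroup = p ^ (r - 1) * (p - 1) := by
  rw [scalarSubgroup, MonoidHom.range_eq_map, ← Subgroup.relIndex_comap, Subgroup.relIndex_top_right,
    comap_scalar_congruenceSubgroup, index_ker_unitsMap_toZModPow hr]

/-! ## Reduction of `GL₂(ℤ_p)` modulo `pʳ` is surjective -/

/-- **Reduction `GL₂(ℤ_p) → GL₂(ℤ/pʳℤ)` is surjective.** [folklore] -/
theorem map_toZModPow_surjective (r : ℕ) :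
    Function.Surjective (Matrix.GeneralLinearGroup.map (PadicInt.toZModPow (p := p) r) :
      GL (Fin 2) ℤ_[p] →* GL (Fin 2) (ZMod (p ^ r))) := by
  rcases Nat.eq_zero_or_pos r with rfl | hr
  · -- `ZMod 1` is trivial
    intro g
    refine ⟨1, ?_⟩
    have : Subsingleton (GL (Fin 2) (ZMod (p ^ 0))) := by
      rw [pow_zero]
      infer_instance
    exact Subsingleton.elim _ _
  · intro g
    -- lift the entries
    let M : Matrix (Fin 2) (Fin 2) ℤ_[p] := Matrix.of fun i j ↦ (((g : Matrix (Fin 2) (Fin 2) (ZMod (p ^ r))) i j).val : ℕ)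
    have hM : M.map (PadicInt.toZModPow r) = (g : Matrix (Fin 2) (Fin 2) (ZMod (p ^ r))) := by
      ext i j
      simp only [Matrix.map_apply, M, Matrix.of_apply, toZModPow_natCast_val]
    have hdet : IsUnit M.det := by
      rw [isUnit_iff_isUnit_toZModPow hr, RingHom.map_det, RingHom.mapMatrix_apply, hM,
        ← Matrix.GeneralLinearGroup.val_det_apply]
      exact Units.isUnit _
    obtain ⟨u, hu⟩ := hdet
    refine ⟨⟨M, (↑u⁻¹ : ℤ_[p]) • M.adjugate, ?_, ?_⟩, ?_⟩
    · rw [Matrix.mul_smul, Matrix.mul_adjugate, ← hu, smul_smul, Units.inv_mul, one_smul]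
    · rw [Matrix.smul_mul, Matrix.adjugate_mul, ← hu, smul_smul, Units.inv_mul, one_smul]
    · exact Units.ext hM

/-- Hence `[GL₂(ℤ_p) : K_r] = |GL₂(ℤ/pʳℤ)|`. [folklore] -/
theorem index_congruenceSubgroup_eq_card (r : ℕ) :
    (congruenceSubgroup (p := p) r).index = Nat.card (GL (Fin 2) (ZMod (p ^ r))) := by
  rw [congruenceSubgroup, Subgroup.index_ker, MonoidHom.range_eq_top.mpr (map_toZModPow_surjective r),
    Subgroup.card_top]

/-! ## `|GL₂(ℤ/pʳℤ)|` -/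

/-- A residue modulo `pʳ` (`r ≥ 1`) is a unit iff its reduction modulo `p` is nonzero. [folklore] -/
theorem zmod_isUnit_iff_cast_ne_zero {r : ℕ} (hr : 1 ≤ r) (x : ZMod (p ^ r)) :
    IsUnit x ↔ (ZMod.castHom (dvd_pow_self p (by omega)) (ZMod p) x) ≠ 0 := by
  rw [← ZMod.natCast_zmod_val x, map_natCast, ZMod.isUnit_iff_coprime, Ne,
    ZMod.natCast_eq_zero_iff]
  rw [Nat.coprime_pow_right_iff hr, Nat.coprime_comm, Nat.Prime.coprime_iff_not_dvd (Fact.out : p.Prime)]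

/-- The kernel of `ℤ/pʳℤ → ℤ/pℤ` has `p^{r−1}` elements. [folklore] -/
theorem card_ker_zmod_castHom {r : ℕ} (hr : 1 ≤ r) :
    Nat.card (ZMod.castHom (dvd_pow_self p (by omega)) (ZMod p) : ZMod (p ^ r) →+* ZMod p).toAddMonoidHom.ker =
      p ^ (r - 1) := by
  have hsurj : Function.Surjective (ZMod.castHom (dvd_pow_self p (by omega)) (ZMod p) : ZMod (p ^ r) →+* ZMod p) :=
    ZMod.castHom_surjective _
  have hidx : (ZMod.castHom (dvd_pow_self p (by omega)) (ZMod p) : ZMod (p ^ r) →+* ZMod p).toAddMonoidHom.ker.index = p := by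
    rw [AddSubgroup.index_ker, AddMonoidHom.range_eq_top.mpr hsurj, AddSubgroup.card_top, Nat.card_eq_fintype_card,
      ZMod.card]
  have hmul := (ZMod.castHom (dvd_pow_self p (by omega)) (ZMod p) : ZMod (p ^ r) →+* ZMod p).toAddMonoidHom.ker.card_mul_index
  rw [hidx] at hmul
  have htot : Nat.card (ZMod (p ^ r)) = p ^ r := by rw [Nat.card_eq_fintype_card, ZMod.card]
  rw [htot] at hmul
  have hr' : p ^ r = p ^ (r - 1) * p := by rw [← pow_succ]; congr 1; omega
  exact Nat.eq_of_mul_eq_mul_right (Fact.out : p.Prime).pos (hmul.trans hr')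

/-- The fibres of `ℤ/pʳℤ → ℤ/pℤ` have `p^{r−1}` elements. [folklore] -/
theorem card_fiber_zmod_castHom {r : ℕ} (hr : 1 ≤ r) (a : ZMod p) :
    Nat.card {x : ZMod (p ^ r) // ZMod.castHom (dvd_pow_self p (by omega)) (ZMod p) x = a} = p ^ (r - 1) := by
  obtain ⟨x₀, hx₀⟩ := ZMod.castHom_surjective (m := p) (n := p ^ r) (dvd_pow_self p (by omega)) a
  rw [← card_ker_zmod_castHom hr]
  refine Nat.card_congr ⟨fun x ↦ ⟨x.1 - x₀, ?_⟩, fun k ↦ ⟨k.1 + x₀, ?_⟩, fun x ↦ by simp, fun k ↦ by simp⟩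
  · rw [AddMonoidHom.mem_ker, RingHom.toAddMonoidHom_eq_coe, AddMonoidHom.coe_coe, map_sub, x.2, hx₀, sub_self]
  · have hk : ZMod.castHom (dvd_pow_self p (by omega)) (ZMod p) k.1 = 0 := (AddMonoidHom.mem_ker).mp k.2
    change ZMod.castHom (dvd_pow_self p (by omega)) (ZMod p) (k.1 + x₀) = a
    rw [map_add, hk, hx₀, zero_add]

/-- The fibres of the entrywise reduction `M₂(ℤ/pʳℤ) → M₂(ℤ/pℤ)` have `p^{4(r−1)}` elements.
[folklore] -/
theorem card_fiber_matrix_map {r : ℕ} (hr : 1 ≤ r) (A : Matrix (Fin 2) (Fin 2) (ZMod p)) :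
    Nat.card {M : Matrix (Fin 2) (Fin 2) (ZMod (p ^ r)) //
      M.map (ZMod.castHom (dvd_pow_self p (by omega)) (ZMod p)) = A} = p ^ (4 * (r - 1)) := by
  -- a fibre of the entrywise map is a product of fibres
  have e : {M : Matrix (Fin 2) (Fin 2) (ZMod (p ^ r)) // M.map (ZMod.castHom (dvd_pow_self p (by omega)) (ZMod p)) = A} ≃
      (∀ ij : Fin 2 × Fin 2, {x : ZMod (p ^ r) // ZMod.castHom (dvd_pow_self p (by omega)) (ZMod p) x = A ij.1 ij.2}) :=
    { toFun := fun M ij ↦ ⟨M.1 ij.1 ij.2, by have := M.2; rw [← Matrix.ext_iff] at this; exact this ij.1 ij.2⟩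
      invFun := fun v ↦ ⟨Matrix.of fun i j ↦ (v (i, j)).1, by ext i j; exact (v (i, j)).2⟩
      left_inv := fun M ↦ by ext i j; rfl
      right_inv := fun v ↦ by funext ij; rfl }
  rw [Nat.card_congr e, Nat.card_pi]
  simp only [card_fiber_zmod_castHom hr, Finset.prod_const, Finset.card_univ, Fintype.card_prod, Fintype.card_fin]
  rw [← pow_mul]; norm_num [mul_comm]

/-- **`|GL₂(ℤ/pʳℤ)| = p^{4(r−1)} · (p² − 1)(p² − p)`** for `r ≥ 1`. [folklore] -/
theorem card_GL_two_zmod_primePow {r : ℕ} (hr : 1 ≤ r) :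
    Nat.card (GL (Fin 2) (ZMod (p ^ r))) = p ^ (4 * (r - 1)) * ((p ^ 2 - 1) * (p ^ 2 - p)) := by
  -- `GL₂(R) ≃ {M // IsUnit (det M)}`
  have e1 : GL (Fin 2) (ZMod (p ^ r)) ≃ {M : Matrix (Fin 2) (Fin 2) (ZMod (p ^ r)) // IsUnit M.det} :=
    { toFun := fun g ↦ ⟨g, by rw [← Matrix.GeneralLinearGroup.val_det_apply]; exact Units.isUnit _⟩
      invFun := fun M ↦ Matrix.GeneralLinearGroup.mk'' M.1 M.2
      left_inv := fun g ↦ Units.ext rfl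
      right_inv := fun M ↦ rfl }
  -- `IsUnit (det M) ↔ det (M mod p) ≠ 0`
  have hunit : ∀ M : Matrix (Fin 2) (Fin 2) (ZMod (p ^ r)),
      IsUnit M.det ↔ (M.map (ZMod.castHom (dvd_pow_self p (by omega)) (ZMod p))).det ≠ 0 := fun M ↦ by
    rw [zmod_isUnit_iff_cast_ne_zero hr, ← RingHom.mapMatrix_apply, ← RingHom.map_det]
  -- count fibre by fibre over `GL₂(𝔽_p)`: the reduction map on the unit-determinant matrices
  let red : {M : Matrix (Fin 2) (Fin 2) (ZMod (p ^ r)) // IsUnit M.det} → {A : Matrix (Fin 2) (Fin 2) (ZMod p) // A.det ≠ 0} :=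
    fun M ↦ ⟨M.1.map (ZMod.castHom (dvd_pow_self p (by omega)) (ZMod p)), (hunit M.1).mp M.2⟩
  have e2 : {M : Matrix (Fin 2) (Fin 2) (ZMod (p ^ r)) // IsUnit M.det} ≃
      Σ A : {A : Matrix (Fin 2) (Fin 2) (ZMod p) // A.det ≠ 0}, {M // red M = A} :=
    (Equiv.sigmaFiberEquiv red).symm
  have efib : ∀ A : {A : Matrix (Fin 2) (Fin 2) (ZMod p) // A.det ≠ 0},
      {M // red M = A} ≃ {M : Matrix (Fin 2) (Fin 2) (ZMod (p ^ r)) // M.map (ZMod.castHom (dvd_pow_self p (by omega)) (ZMod p)) = A.1} :=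
    fun A ↦
    { toFun := fun M ↦ ⟨M.1.1, congrArg Subtype.val M.2⟩
      invFun := fun N ↦ ⟨⟨N.1, (hunit N.1).mpr (by rw [N.2]; exact A.2)⟩, Subtype.ext N.2⟩
      left_inv := fun M ↦ rfl
      right_inv := fun N ↦ rfl }
  have e3 : {A : Matrix (Fin 2) (Fin 2) (ZMod p) // A.det ≠ 0} ≃ GL (Fin 2) (ZMod p) :=
    { toFun := fun A ↦ Matrix.GeneralLinearGroup.mkOfDetNeZero A.1 A.2
      invFun := fun g ↦ ⟨g, by
        rw [← Matrix.GeneralLinearGroup.val_det_apply]; exact Units.ne_zero _⟩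
      left_inv := fun A ↦ rfl
      right_inv := fun g ↦ Units.ext rfl }
  rw [Nat.card_congr e1, Nat.card_congr e2, Nat.card_sigma]
  simp only [fun A ↦ Nat.card_congr (efib A), card_fiber_matrix_map hr, Finset.sum_const, Finset.card_univ,
    smul_eq_mul]
  rw [← Nat.card_eq_fintype_card, Nat.card_congr e3, Matrix.card_GL_field]
  simp only [ZMod.card, Fin.prod_univ_two, Fin.val_zero, pow_zero, Fin.val_one, pow_one]
  ring

/-! ## The indices -/

/-- **`[GL₂(ℤ_p) : K_r] = p^{4(r−1)} (p² − 1)(p² − p)`** for `r ≥ 1`. [folklore] -/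
theorem index_congruenceSubgroup {r : ℕ} (hr : 1 ≤ r) :
    (congruenceSubgroup (p := p) r).index = p ^ (4 * (r - 1)) * ((p ^ 2 - 1) * (p ^ 2 - p)) := by
  rw [index_congruenceSubgroup_eq_card, card_GL_two_zmod_primePow hr]

/-- `K_r` has finite index. [folklore] -/
instance finiteIndex_congruenceSubgroup (r : ℕ) : (congruenceSubgroup (p := p) r).FiniteIndex := by
  refine ⟨?_⟩
  rcases Nat.eq_zero_or_pos r with rfl | hr
  · rw [index_congruenceSubgroup_eq_card]
    have : Finite (GL (Fin 2) (ZMod (p ^ 0))) := by rw [pow_zero]; infer_instance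
    exact Nat.card_pos.ne'
  · rw [index_congruenceSubgroup hr]
    have hp := (Fact.out : p.Prime).two_le
    have h1 : 0 < p ^ 2 - 1 := by
      have : 4 ≤ p ^ 2 := by nlinarith
      omega
    have h2 : 0 < p ^ 2 - p := by
      have : p < p ^ 2 := by nlinarith
      omega
    positivity

/-- **`[GL₂(ℤ_p) : ℤ_pˣ · K_r] = p^{3r−2} (p² − 1)`** (`= |PGL₂(ℤ/pʳℤ)| = p^{3r}(1 − p⁻²)`) for
`r ≥ 1` — the count behind `Vol(PGL₂(ℤ_p)) = 1 − p⁻²`. [cite: BhargavaShankarAnnals2015, Prop. 5.12 proof (Vol(PGL₂(ℤ_p)); arXiv:1006.1002v2 numbering)] -/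
theorem index_scalar_sup_congruenceSubgroup {r : ℕ} (hr : 1 ≤ r) :
    (scalarSubgroup ⊔ congruenceSubgroup (p := p) r).index = p ^ (3 * r - 2) * (p ^ 2 - 1) := by
  have hmul := Subgroup.relIndex_mul_index (H := congruenceSubgroup (p := p) r)
    (K := scalarSubgroup ⊔ congruenceSubgroup r) le_sup_right
  rw [Subgroup.relIndex_sup_right, relIndex_congruenceSubgroup_scalarSubgroup hr, index_congruenceSubgroup hr] at hmul
  -- `p^{r-1}(p-1) · X = p^{4(r-1)} (p²-1)(p²-p)`
  have hp := (Fact.out : p.Prime).pos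
  have hp1 : 0 < p - 1 := by have := (Fact.out : p.Prime).two_le; omega
  have key : p ^ (r - 1) * (p - 1) * (p ^ (3 * r - 2) * (p ^ 2 - 1)) = p ^ (4 * (r - 1)) * ((p ^ 2 - 1) * (p ^ 2 - p)) := by
    have h2 : p ^ 2 - p = p * (p - 1) := by
      rw [Nat.mul_sub_one, sq]
    rw [h2]
    have h3 : p ^ (4 * (r - 1)) * p = p ^ (r - 1) * p ^ (3 * r - 2) := by
      rw [← pow_succ, ← pow_add]; congr 1; omega
    calc p ^ (r - 1) * (p - 1) * (p ^ (3 * r - 2) * (p ^ 2 - 1))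
        = (p ^ (r - 1) * p ^ (3 * r - 2)) * ((p ^ 2 - 1) * (p - 1)) := by ring
      _ = (p ^ (4 * (r - 1)) * p) * ((p ^ 2 - 1) * (p - 1)) := by rw [h3]
      _ = _ := by ring
  have hne : p ^ (r - 1) * (p - 1) ≠ 0 := by positivity
  apply Nat.eq_of_mul_eq_mul_left (Nat.pos_of_ne_zero hne)
  rw [hmul, key]

/-- `ℤ_pˣ · K_r` has finite index. [folklore] -/
instance finiteIndex_scalar_sup_congruenceSubgroup (r : ℕ) :
    (scalarSubgroup ⊔ congruenceSubgroup (p := p) r).FiniteIndex :=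
  Subgroup.finiteIndex_of_le le_sup_right

end GL2

end Literature.GroupTheory.Index

end
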